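import Summits.BirchSwinnertonDyer.BirchSwinnertonDyer.Theorems.UniversalToricDescentThinCombVerticalInvisibility
import HarnessLib

/-!
# RESIDUAL INVISIBILITY: the rational thin comb is blind to every element of `Λ₂(𝒪)` that is VERTICAL MODULO `p`
# — a class STRICTLY LARGER than the vertical elements (witness `T₂ + p·T₁`)
# (crux `RationalSplitIMCInclusionAtThree`, stmt-BirchSwinnertonDyer-24207, line `ratwall_thin_comb`; helper,
# `--supports stmt-BirchSwinnertonDyer-24207`; cell `pub/bsd-wall`, LEAD `cruxlead-24207` g25)

WHY THIS FILE. `…ThinComb.VerticalInvisibility` (this seat, p763523) certifies that the per-tooth slack of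
`ThinCombDvdRat 𝒪 p G F` absorbs every non-zero VERTICAL factor `h(T₂)` of `G`. The lead census (`LEAD-CENSUS-g16.md`
§1 item 3) also asserts the converse in prose — the slack absorbs «nothing of the Weierstrass (non-vertical) part of
`G`». THAT HALF IS FALSE, and this file lands the correction as kernel theorems:

* §1 the explicit form of `p ∈ (h, E_m)`: for `h = X^λ + p·s`, `λ < deg E_m`, there are `α, β ∈ 𝒪⟦X⟧` with
  `α·h + β·E_m = p` AND `X ∣ α` (`exists_X_dvd_lincomb_of_eq_X_pow_add`; `α = −X^{d−λ}·u⁻¹`).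
* §2 **RESIDUALLY VERTICAL elements are invisible**: every `Q = h(T₂)·v + p·R ∈ Λ₂(𝒪)` with `h = X^λ + p·s`, `v` a
  unit and `R` ARBITRARY — i.e. every `Q` whose reduction modulo `p` is `T₂^λ·(unit)` — satisfies `p ∈ (Q, E_m(T₂))`
  on every level with `deg E_m > λ` (`const_natCast_mem_span_of_residuallyVertical`: `p·(1 + T₂·γ) ∈ (Q, E_m)` and
  `1 + T₂·γ` is a unit), hence `ThinCombDvdRat 𝒪 p G F → ThinCombDvdRat 𝒪 p (Q·G) F`
  (`ThinCombDvdRat.mul_of_residuallyVertical`, slack `+1`).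
* §3 the WITNESS `Q₀ = T₂ + p·T₁` (a genuinely two-variable prime element, `Λ₂/(Q₀) ≅ 𝒪⟦T₁⟧`): `ThinCombDvdRat 𝒪 p Q₀ 1`
  (`thinCombDvdRat_T₂_add_pT₁_one`), `Q₀ ∤ p^a` whenever `p^a ≠ 0` (`T₂_add_pT₁_not_dvd_const_pow`), and `Q₀` is NOT a
  vertical element times a unit when `𝒪` is a domain with `p ≠ 0` (`T₂_add_pT₁_not_vertical`). §4: the same in the
  crux's ring `Λ₂(unrIntegers 3)`, `p = 3`.

CORRECTED READING FOR THE STUB (`stub_ratCombDvdUpTo2`: `ThinCombDvdRat R₀ 3 g L₂`, `(g) = Ch_{Λ₂}(X₂)`). Rational comb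
divisibility constrains `g` only modulo the multiplicatively closed class of COMB-INVISIBLE elements, which contains
all units, `3`, every non-zero vertical `h(T₂)` (VerticalInvisibility) and every residually vertical
`T₂^λ·v + 3·R` (this file) — in particular non-vertical primes such as `T₂ + 3T₁`. In the composition
`RationalSplitIMCInclusionAtThree_of` such factors of `g` are recovered NOT by the comb but by the two functional
equations: the frame involution `φ_{A_τ}` moves a residually-`T₂`-vertical prime to a residually-`T₁`-vertical one,
which the comb SEES (tree `…ThinCombVisibility.not_shape_of_not_mem_span_T₂`), and `φ_{A_τ} L₂ ∼ L₂` carries the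
divisibility back (`dvd_pow_mul_of_weakReflection`). This is exactly why `…RatCombTightness` found both symmetries
necessary; the present file names the full blind spot.

HONEST FRAMING. Commutative algebra about the SHAPE of one registered stub; nothing here is evidence for or against the
stub; BSD is not proved for any curve by any of this.

References: [cite: Washington1997, Lemma 1.4, §7.1–§7.2 (distinguished polynomials, `Φ_{p^{m+1}}(1) = p`, units of
`Λ`)].
-/

set_option linter.dupNamespace false
set_option autoImplicit false

noncomputable section

namespace Summit.BirchSwinnertonDyer.BirchSwinnertonDyer.Theorems.UniversalToricDescentThinComb.ResidualInvisibility

open Polynomial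
open Literature.NumberTheory.EllipticCurves
open Summit.BirchSwinnertonDyer.BirchSwinnertonDyer.Theorems.UniversalToricDescentThinComb

/-! ## §1 `α·h + β·E_m = p` with `X ∣ α` -/

section Algebra

variable (𝒪 : Type*) [CommRing 𝒪] (p : ℕ) [hp : Fact p.Prime]

/-- **Explicit `p ∈ (h, E_m)`**: for `h = X^λ + p·s` and `λ < d = deg E_m` there are `α, β` with `α·h + β·E_m = p`
and `X ∣ α` — indeed `α = −X^{d−λ}·u⁻¹`, `β = u⁻¹` for the unit `u = w − X^{d−λ}·s`, `E_m = X^d + p·w`.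
[cite: Washington1997, Lemma 1.4 and §7.1] -/
theorem exists_X_dvd_lincomb_of_eq_X_pow_add {h s : PowerSeries 𝒪} {l m : ℕ}
    (hh : h = PowerSeries.X ^ l + PowerSeries.C (p : 𝒪) * s) (hl : l < (combPoly p m).natDegree) :
    ∃ α β : PowerSeries 𝒪, PowerSeries.X ∣ α ∧ α * h + β * combSeries 𝒪 p m = PowerSeries.C (p : 𝒪) := by
  obtain ⟨w, hw1, hw⟩ := combSeries_eq_X_pow_add 𝒪 p m
  set d := (combPoly p m).natDegree with hd
  have hu : IsUnit (w - PowerSeries.X ^ (d - l) * s) := by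
    rw [PowerSeries.isUnit_iff_constantCoeff, map_sub, map_mul, map_pow, PowerSeries.constantCoeff_X,
      zero_pow (Nat.sub_ne_zero_of_lt hl), zero_mul, sub_zero, hw1]
    exact isUnit_one
  obtain ⟨u, hu'⟩ := hu
  have key : PowerSeries.C (p : 𝒪) * (w - PowerSeries.X ^ (d - l) * s) =
      combSeries 𝒪 p m - PowerSeries.X ^ (d - l) * h := by
    have hX : (PowerSeries.X : PowerSeries 𝒪) ^ d = PowerSeries.X ^ (d - l) * PowerSeries.X ^ l := by
      rw [← pow_add, Nat.sub_add_cancel hl.le]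
    rw [hw, hh, hX]
    ring
  refine ⟨-(PowerSeries.X ^ (d - l) : PowerSeries 𝒪) * ((u⁻¹ : (PowerSeries 𝒪)ˣ) : PowerSeries 𝒪),
    ((u⁻¹ : (PowerSeries 𝒪)ˣ) : PowerSeries 𝒪), ?_, ?_⟩
  · refine ⟨-(PowerSeries.X ^ (d - l - 1) : PowerSeries 𝒪) * ((u⁻¹ : (PowerSeries 𝒪)ˣ) : PowerSeries 𝒪), ?_⟩
    have hX' : (PowerSeries.X : PowerSeries 𝒪) ^ (d - l) = PowerSeries.X * PowerSeries.X ^ (d - l - 1) := by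
      rw [← pow_succ', Nat.sub_add_cancel (Nat.le_sub_of_add_le' hl)]
    rw [hX']
    ring
  · calc -(PowerSeries.X ^ (d - l) : PowerSeries 𝒪) * ((u⁻¹ : (PowerSeries 𝒪)ˣ) : PowerSeries 𝒪) * h +
          ((u⁻¹ : (PowerSeries 𝒪)ˣ) : PowerSeries 𝒪) * combSeries 𝒪 p m
        = (combSeries 𝒪 p m - PowerSeries.X ^ (d - l) * h) * ((u⁻¹ : (PowerSeries 𝒪)ˣ) : PowerSeries 𝒪) := by ring
      _ = PowerSeries.C (p : 𝒪) * (w - PowerSeries.X ^ (d - l) * s) * ((u⁻¹ : (PowerSeries 𝒪)ˣ) : PowerSeries 𝒪) := by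
          rw [key]
      _ = PowerSeries.C (p : 𝒪) := by rw [← hu', mul_assoc, Units.mul_inv, mul_one]

/-- The same lifted to `Λ₂(𝒪) = 𝒪⟦T₂⟧⟦T₁⟧`: `A·h(T₂) + B·E_m(T₂) = p` with `T₂ ∣ A`.
[cite: Washington1997, Lemma 1.4 and §7.1] -/
theorem exists_T₂_dvd_lincomb_of_eq_X_pow_add {h s : PowerSeries 𝒪} {l m : ℕ}
    (hh : h = PowerSeries.X ^ l + PowerSeries.C (p : 𝒪) * s) (hl : l < (combPoly p m).natDegree) :
    ∃ A B : PowerSeries (PowerSeries 𝒪), T₂ 𝒪 ∣ A ∧ A * PowerSeries.C h + B * combElt 𝒪 p m = const 𝒪 (p : 𝒪) := by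
  obtain ⟨α, β, hXα, hαβ⟩ := exists_X_dvd_lincomb_of_eq_X_pow_add 𝒪 p hh hl
  refine ⟨PowerSeries.C α, PowerSeries.C β, map_dvd PowerSeries.C hXα, ?_⟩
  rw [combElt, ← map_mul, ← map_mul, ← map_add, hαβ]
  rfl

/-! ## §2 Residually vertical elements are invisible -/

omit hp in
/-- `1 + T₂·γ` is a unit of `Λ₂(𝒪)` for every `γ` (its constant term is `1`). [cite: Washington1997, §7.1] -/
theorem isUnit_one_add_T₂_mul (γ : PowerSeries (PowerSeries 𝒪)) : IsUnit (1 + T₂ 𝒪 * γ) := by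
  rw [PowerSeries.isUnit_iff_constantCoeff, map_add, map_one, map_mul, T₂, PowerSeries.constantCoeff_C,
    PowerSeries.isUnit_iff_constantCoeff, map_add, map_one, map_mul, PowerSeries.constantCoeff_X, zero_mul, add_zero]
  exact isUnit_one

/-- **`p ∈ (Q, E_m(T₂))` for every RESIDUALLY VERTICAL `Q`**: if `Q = h(T₂)·v + p·R` with `h = X^λ + p·s`, `v` a unit
of `Λ₂(𝒪)` and `R ∈ Λ₂(𝒪)` arbitrary, then `p ∈ (Q, E_m(T₂))` on every level with `deg E_m > λ`. Proof: with
`A·h(T₂) + B·E_m = p`, `T₂ ∣ A` (§1) and `h(T₂) = (Q − p·R)·v⁻¹` one gets `p·(1 + A·v⁻¹·R) = A·v⁻¹·Q + B·E_m`, and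
`1 + A·v⁻¹·R = 1 + T₂·(…)` is a unit. [cite: Washington1997, Lemma 1.4 and §7.1] -/
theorem const_natCast_mem_span_of_residuallyVertical {h s : PowerSeries 𝒪} {l m : ℕ}
    (hh : h = PowerSeries.X ^ l + PowerSeries.C (p : 𝒪) * s) (hl : l < (combPoly p m).natDegree)
    {v R Q : PowerSeries (PowerSeries 𝒪)} (hv : IsUnit v) (hQ : Q = PowerSeries.C h * v + const 𝒪 (p : 𝒪) * R) :
    const 𝒪 (p : 𝒪) ∈ Ideal.span {Q, combElt 𝒪 p m} := by
  obtain ⟨A, B, ⟨A', rfl⟩, hAB⟩ := exists_T₂_dvd_lincomb_of_eq_X_pow_add 𝒪 p hh hl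
  obtain ⟨w, rfl⟩ := hv
  have hCh : PowerSeries.C h = (Q - const 𝒪 (p : 𝒪) * R) * ((w⁻¹ : (PowerSeries (PowerSeries 𝒪))ˣ) :
      PowerSeries (PowerSeries 𝒪)) := by
    rw [hQ, add_sub_cancel_right, Units.mul_inv_cancel_right]
  have key : const 𝒪 (p : 𝒪) * (1 + T₂ 𝒪 * (A' * ((w⁻¹ : (PowerSeries (PowerSeries 𝒪))ˣ) :
      PowerSeries (PowerSeries 𝒪)) * R)) =
      T₂ 𝒪 * A' * ((w⁻¹ : (PowerSeries (PowerSeries 𝒪))ˣ) : PowerSeries (PowerSeries 𝒪)) * Q +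
        B * combElt 𝒪 p m := by
    rw [hCh] at hAB
    linear_combination -hAB
  obtain ⟨e, he⟩ := isUnit_one_add_T₂_mul 𝒪 (A' * ((w⁻¹ : (PowerSeries (PowerSeries 𝒪))ˣ) :
    PowerSeries (PowerSeries 𝒪)) * R)
  rw [← he] at key
  rw [Ideal.mem_span_pair]
  refine ⟨T₂ 𝒪 * A' * ((w⁻¹ : (PowerSeries (PowerSeries 𝒪))ˣ) : PowerSeries (PowerSeries 𝒪)) *
      ((e⁻¹ : (PowerSeries (PowerSeries 𝒪))ˣ) : PowerSeries (PowerSeries 𝒪)),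
    B * ((e⁻¹ : (PowerSeries (PowerSeries 𝒪))ˣ) : PowerSeries (PowerSeries 𝒪)), ?_⟩
  calc T₂ 𝒪 * A' * ((w⁻¹ : (PowerSeries (PowerSeries 𝒪))ˣ) : PowerSeries (PowerSeries 𝒪)) *
          ((e⁻¹ : (PowerSeries (PowerSeries 𝒪))ˣ) : PowerSeries (PowerSeries 𝒪)) * Q +
        B * ((e⁻¹ : (PowerSeries (PowerSeries 𝒪))ˣ) : PowerSeries (PowerSeries 𝒪)) * combElt 𝒪 p m
      = (T₂ 𝒪 * A' * ((w⁻¹ : (PowerSeries (PowerSeries 𝒪))ˣ) : PowerSeries (PowerSeries 𝒪)) * Q +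
          B * combElt 𝒪 p m) * ((e⁻¹ : (PowerSeries (PowerSeries 𝒪))ˣ) : PowerSeries (PowerSeries 𝒪)) := by ring
    _ = const 𝒪 (p : 𝒪) * ↑e * ((e⁻¹ : (PowerSeries (PowerSeries 𝒪))ˣ) : PowerSeries (PowerSeries 𝒪)) := by
          rw [key]
    _ = const 𝒪 (p : 𝒪) := by rw [mul_assoc, Units.mul_inv, mul_one]

/-- **RESIDUALLY VERTICAL elements are invisible to the rational comb**: for `Q = h(T₂)·v + p·R` as above (reduction
of `Q` modulo `p` = `T₂^λ·(unit)`), `ThinCombDvdRat 𝒪 p G F → ThinCombDvdRat 𝒪 p (Q·G) F` (slack `+1` on every level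
`m ≥ λ`). With `R = 0` this is `VerticalInvisibility.ThinCombDvdRat.C_mul_of_eq_X_pow_add` (times a unit); with
`h = X`, `v = 1`, `R = T₁` it applies to the NON-vertical prime `T₂ + p·T₁` (§3). [cite: Washington1997, Lemma 1.4 and §7.1] -/
theorem ThinCombDvdRat.mul_of_residuallyVertical {h s : PowerSeries 𝒪} {l : ℕ}
    (hh : h = PowerSeries.X ^ l + PowerSeries.C (p : 𝒪) * s)
    {v R Q : PowerSeries (PowerSeries 𝒪)} (hv : IsUnit v) (hQ : Q = PowerSeries.C h * v + const 𝒪 (p : 𝒪) * R)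
    {G F : PowerSeries (PowerSeries 𝒪)} (hGF : ThinCombDvdRat 𝒪 p G F) :
    ThinCombDvdRat 𝒪 p (Q * G) F := by
  refine VerticalInvisibility.ThinCombDvdRat.mul_of_const_pow_mem 𝒪 p (m₀ := l) (s := 1) (fun m hm ↦ ?_) hGF
  rw [pow_one]
  exact const_natCast_mem_span_of_residuallyVertical 𝒪 p hh (lt_of_le_of_lt hm (lt_natDegree_combPoly p m)) hv hQ

/-! ## §3 The witness `Q₀ = T₂ + p·T₁`: invisible, divides no `p^a`, and NOT vertical -/

/-- `Q₀ = T₂ + p·T₁` is residually vertical (`h = X`, `v = 1`, `R = T₁`), hence **comb-invisible**: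
`ThinCombDvdRat 𝒪 p (T₂ + p·T₁) 1`. [cite: Washington1997, Lemma 1.4 and §7.1] -/
theorem thinCombDvdRat_T₂_add_pT₁_one : ThinCombDvdRat 𝒪 p (T₂ 𝒪 + const 𝒪 (p : 𝒪) * T₁ 𝒪) 1 := by
  have hX : (PowerSeries.X : PowerSeries 𝒪) = PowerSeries.X ^ 1 + PowerSeries.C (p : 𝒪) * 0 := by
    rw [pow_one, mul_zero, add_zero]
  have hQ : T₂ 𝒪 + const 𝒪 (p : 𝒪) * T₁ 𝒪 = PowerSeries.C PowerSeries.X * 1 + const 𝒪 (p : 𝒪) * T₁ 𝒪 := by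
    rw [mul_one]; rfl
  simpa only [mul_one] using
    ThinCombDvdRat.mul_of_residuallyVertical 𝒪 p hX isUnit_one hQ
      (RatCombTightness.thinCombDvdRat_of_dvd 𝒪 p (dvd_refl (1 : PowerSeries (PowerSeries 𝒪))))

omit hp in
/-- … yet `Q₀ = T₂ + p·T₁` divides no `p^a` with `p^a ≠ 0` (read the `T₁`-constant term: `T₂·q₀ = p^a`, then the
`T₂`-constant term: `0 = p^a`). [cite: Washington1997, §7.1] -/
theorem T₂_add_pT₁_not_dvd_const_pow {a : ℕ} (hpa : (p : 𝒪) ^ a ≠ 0) :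
    ¬ (T₂ 𝒪 + const 𝒪 (p : 𝒪) * T₁ 𝒪) ∣ const 𝒪 ((p : 𝒪) ^ a) := by
  rintro ⟨q, hq⟩
  have h1 := congrArg PowerSeries.constantCoeff hq
  rw [map_mul, map_add, map_mul, T₂, T₁, const, RingHom.comp_apply, RingHom.comp_apply, PowerSeries.constantCoeff_C,
    PowerSeries.constantCoeff_C, PowerSeries.constantCoeff_C, PowerSeries.constantCoeff_X, mul_zero, add_zero] at h1
  have h2 := congrArg PowerSeries.constantCoeff h1
  rw [PowerSeries.constantCoeff_C, map_mul, PowerSeries.constantCoeff_X, zero_mul] at h2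
  exact hpa h2

omit hp in
/-- … and `Q₀ = T₂ + p·T₁` is **NOT a vertical element times a unit** when `𝒪` is a domain with `p ≠ 0`: from
`T₂ + p·T₁ = h(T₂)·u` read the `T₁`-constant terms (`X = h·u₀`) and the `T₁`-linear terms (`p = h·u₁`); then either
`h(0) = 0`, so `X ∣ h ∣ p` forces `p = 0`, or `u₀(0) = 0`, impossible for the unit `u`. So the comb-invisible class
is STRICTLY LARGER than {vertical}·{units}. [cite: Washington1997, §7.1] -/
theorem T₂_add_pT₁_not_vertical [IsDomain 𝒪] (hp0 : (p : 𝒪) ≠ 0) :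
    ¬ ∃ (h : PowerSeries 𝒪) (u : PowerSeries (PowerSeries 𝒪)), IsUnit u ∧
        T₂ 𝒪 + const 𝒪 (p : 𝒪) * T₁ 𝒪 = PowerSeries.C h * u := by
  rintro ⟨h, u, hu, hQ⟩
  -- `T₁`-constant terms: `X = h · u₀`
  have h0 := congrArg PowerSeries.constantCoeff hQ
  rw [map_add, map_mul, map_mul, T₂, T₁, const, RingHom.comp_apply, PowerSeries.constantCoeff_C,
    PowerSeries.constantCoeff_C, PowerSeries.constantCoeff_C, PowerSeries.constantCoeff_X, mul_zero, add_zero] at h0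
  -- `T₁`-linear terms: `p = h · u₁`
  have h1 := congrArg (PowerSeries.coeff 1) hQ
  rw [map_add, T₂, T₁, const, RingHom.comp_apply, PowerSeries.coeff_C, if_neg one_ne_zero, zero_add,
    PowerSeries.coeff_C_mul, PowerSeries.coeff_one_X, mul_one, PowerSeries.coeff_C_mul] at h1
  -- constant terms in `𝒪`: `h(0) · u₀(0) = 0`
  have h00 := congrArg PowerSeries.constantCoeff h0
  rw [PowerSeries.constantCoeff_X, map_mul] at h00
  rcases mul_eq_zero.mp h00.symm with hh0 | hu0
  · -- `X ∣ h`, hence `X ∣ C p`: `p = 0`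
    obtain ⟨h', rfl⟩ := PowerSeries.X_dvd_iff.mpr hh0
    have := congrArg PowerSeries.constantCoeff h1
    rw [PowerSeries.constantCoeff_C, map_mul, map_mul, PowerSeries.constantCoeff_X, zero_mul, zero_mul] at this
    exact hp0 this
  · -- `u₀(0) = 0` contradicts `u` being a unit
    have hu00 : IsUnit (PowerSeries.constantCoeff (PowerSeries.constantCoeff u)) :=
      PowerSeries.isUnit_constantCoeff _ (PowerSeries.isUnit_constantCoeff _ hu)
    rw [hu0, isUnit_zero_iff] at hu00
    exact zero_ne_one hu00

omit hp in
/-- **Rational comb divisibility alone is not rigid — even off the vertical elements**: if no power of `p` vanishes in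
`𝒪`, the residually vertical, non-vertical `G = T₂ + p·T₁`, `F = 1` satisfy `ThinCombDvdRat 𝒪 p G F` with `G ∤ p^a·F`
for all `a`. [cite: Washington1997, §7.1–§7.2] -/
theorem not_thinCombDvdRat_rigid_T₂_add_pT₁ [Fact p.Prime] (hpa : ∀ a : ℕ, (p : 𝒪) ^ a ≠ 0) :
    ThinCombDvdRat 𝒪 p (T₂ 𝒪 + const 𝒪 (p : 𝒪) * T₁ 𝒪) 1 ∧
      ∀ a : ℕ, ¬ (T₂ 𝒪 + const 𝒪 (p : 𝒪) * T₁ 𝒪) ∣ const 𝒪 ((p : 𝒪) ^ a) * 1 :=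
  ⟨thinCombDvdRat_T₂_add_pT₁_one 𝒪 p, fun a ↦ by
    rw [mul_one]; exact T₂_add_pT₁_not_dvd_const_pow 𝒪 p (hpa a)⟩

end Algebra

/-! ## §4 The crux's ring `Λ₂(R₀)`, `R₀ = unrIntegers 3`, `p = 3` -/

section Unr

/-- **In the crux's ring**: `T₂ + 3T₁ ∈ R₀⟦T₂⟧⟦T₁⟧` is comb-invisible (`ThinCombDvdRat R₀ 3 (T₂ + 3T₁) 1`), divides no
`3^a`, and is not a vertical element times a unit — the rational `3`-comb of `stub_ratCombDvdUpTo2` is blind to a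
class of factors of `g` strictly larger than the vertical ones. [cite: Washington1997, §7.1–§7.2] -/
theorem residuallyVertical_witness_unr :
    ThinCombDvdRat (unrIntegers 3) 3
        (T₂ (unrIntegers 3) + const (unrIntegers 3) (((3 : ℕ) : ℕ) : unrIntegers 3) * T₁ (unrIntegers 3)) 1 ∧
      (∀ a : ℕ, ¬ (T₂ (unrIntegers 3) + const (unrIntegers 3) (((3 : ℕ) : ℕ) : unrIntegers 3) * T₁ (unrIntegers 3)) ∣
          const (unrIntegers 3) ((((3 : ℕ) : ℕ) : unrIntegers 3) ^ a)) ∧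
      ¬ ∃ (h : PowerSeries (unrIntegers 3)) (u : PowerSeries (PowerSeries (unrIntegers 3))), IsUnit u ∧
          T₂ (unrIntegers 3) + const (unrIntegers 3) (((3 : ℕ) : ℕ) : unrIntegers 3) * T₁ (unrIntegers 3) =
            PowerSeries.C h * u := by
  haveI : Fact (Nat.Prime 3) := ⟨Nat.prime_three⟩
  have h3 := RatCombTightness.pow_three_ne_zero_unrIntegers
  refine ⟨thinCombDvdRat_T₂_add_pT₁_one (unrIntegers 3) 3, fun a ↦ T₂_add_pT₁_not_dvd_const_pow (unrIntegers 3) 3 (h3.1 a),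
    T₂_add_pT₁_not_vertical (unrIntegers 3) 3 ?_⟩
  simpa only [pow_one] using h3.1 1

end Unr

end Summit.BirchSwinnertonDyer.BirchSwinnertonDyer.Theorems.UniversalToricDescentThinComb.ResidualInvisibility

end
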